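import Summits.QuantumAdvantage.QuantumAdvantage.Theorems.PebbleDialB

/-! # PebbleDial — part 3/3 (mechanical split for landing of `PebbleDial`; content verbatim; scopes re-opened with their variables) -/

set_option linter.dupNamespace false

namespace Summit.QuantumAdvantage.QuantumAdvantage.Theorems.PebbleDial
open Finset
open Literature.Computability.Complexity
open Literature.Computability.QuantumComplexity
open Summit.QuantumAdvantage.QuantumAdvantage.Theses.AnfPresentation
open Summit.QuantumAdvantage.QuantumAdvantage.Theorems.HintDial (eval_bit bit_injective rungA_of_anfResidual)
open CubicForm (bit)
variable {n : ℕ}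

/-- [line law] … hence the uniform rung `SymRung`. -/
theorem symRung_of_foolingPairs (hS : SupportTheoremANF) (hF : ∀ k, FoolingPairs k) : SymRung :=
  symRung_of_symRungNU (symRungNU_of_foolingPairs hS hF)

/-- [line law] Fooling pairs are monotone in `k` (fewer pebbles are easier to survive). -/
theorem foolingPairs_mono {j k : ℕ} (hjk : j ≤ k) (h : FoolingPairs k) : FoolingPairs j := by
  intro n₀
  obtain ⟨n, hn, he, F, G, F', G', hequiv, h1, h2⟩ := h n₀
  exact ⟨n, hn, he, F, G, F', G', hequiv.mono hjk, h1, h2⟩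

/-- [law · the (D)-caveat typed] WHERE THE RUNG'S CONTENT SITS: the rung with the fooling-pair line is the
conjunction of a T-free combinatorial statement and a print-backed support hypothesis; if both hold, `X` reduces to
its residual `SymLift` ALONE given `RungA` (`X ↔ RungA ∧ SymLift` under the line). -/
theorem anfResidual_iff_of_line (hS : SupportTheoremANF) (hF : ∀ k, FoolingPairs k) :
    AnfResidual ↔ RungA ∧ SymLift :=
  ⟨fun x => ⟨rungA_of_anfResidual x, symLift_of_anfResidual x⟩,
    fun h => h.2 h.1 (symRung_of_foolingPairs hS hF)⟩

/-! ## §5 The quadratic filter — where a fooling pair can NOT live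

Split the line along the QUADRATIC exact sub-slice (both cube tables supported on positions with two equal indices;
the carve-out of `AnfPresentation.QuadRungA`).  Two facts of symmetric computation pull in opposite directions, and
the PROMISE decides between them:
* FPC — hence `P`-uniform polynomial-size symmetric threshold families — can NOT decide solvability of (singular)
  linear systems or matrix rank over `𝔽₂` (Atserias–Bulatov–Dawar 2009; Holm 2012 [galaxy:pdf:1335603900 p.6–7]),
  and the Cai–Fürer–Immerman method is what proves such statements;
* FPC CAN define the characteristic polynomial and the determinant of a matrix over `ℤ`, `ℚ` and every finite
  field, and the INVERSE of an invertible one (Dawar–Grohe–Holm–Laubner 2009 / Holm 2010, as listed in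
  [galaxy:pdf:1335603900 p.7]).
EXACTNESS FORCES NONSINGULARITY.  An exact pair (`|Φ| = 1`) is `(f, f̃ + c)` with `f` bent and `f̃` its dual
(Cauchy–Schwarz), so on the quadratic grade the polar matrix `B_F` is nonsingular, `G` is the dual quadratic form
(polar `B_F⁻¹`) up to its constant bit, and the SIGN is the single bit `G.const ⊕ Arf(F)` with
`Arf(F) = F.const ⊕ q₀(B_F⁻¹ a_F) ⊕ [det_ℤ(A_F) ≡ ±3 (mod 8)]` (`q₀` the pure quadratic part of `F`, `a_F` its
linear part, `A_F` the integer lift of `B_F`; the last summand is the determinant formula for the Arf invariant of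
an even form (Brown; Murasugi–Levine for knots) — checked numerically on all 198 odd-determinant graphs with
`n ≤ 6` and on 50 random exact quadratic pairs, `g14/aux/arf_det_check.py`, 0 mismatches).  Every ingredient is
FPC-definable by the second fact and FPC translates into `P`-uniform polynomial-size symmetric threshold circuits
(Anderson–Dawar 2017; [corpus:paper:dawar2024-limits-symmetric-computation-invited-talk p.2]); so the quadratic
exact slice is — by print facts assembled here, NOT by a tree theorem — symmetric-EASY: `QuadSymEasy` below is the
typed prediction, `QuadSymRung` and `∀ k, QuadFoolingPairs k` are predicted FALSE
(`not_quadFoolingPairs_of_quadSymEasy`, `quadratic_filter`), and `quadratic_absorption` types the other branch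
(were quadratic fooling pairs to exist, every symmetric grade of the rung would close `T`-free and the target would
be its residual `X ↔ RungA ∧ SymLift`).
THE QUADRATIC FILTER (a law about the dial).  Unlike the `AC⁰[⊕]` dial of g13, whose `T`-free core `B_log` IS
linear algebra (iterated unipotent inversion), the symmetric dial is NOT short-circuited by linear algebra: under
`QuadSymEasy` a fooling pair for `SymRung` must be PROPERLY CUBIC (`quadratic_filter`) — e.g. Maiorana–McFarland
pairs with a NONLINEAR inner permutation, whose sign inverts a quadratic permutation rather than a matrix — which
is the regime where the target's own content sits and where no Cai–Fürer–Immerman technology is known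
(IDEA-NEEDED).  Cheapest falsifier of the filter: an FPC formula for the Arf bit fails to exist only if one of the
two cited definability facts is misremembered — both are quoted from the materialised slide p.7. -/

/-- A cubic form is QUADRATIC if its cube table is supported on positions with two equal indices (the convention of
`AnfPresentation.QuadRungA`). -/
def IsQuad (F : CubicForm n) : Prop := ∀ i j l, F.cube i j l = true → (i = j ∨ j = l ∨ i = l)

/-- Quadraticity is isomorphism-invariant. -/
theorem isQuad_permForm (σ : Equiv.Perm (Fin n)) {F : CubicForm n} (hF : IsQuad F) : IsQuad (permForm σ F) := by
  intro i j l h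
  rcases hF (σ i) (σ j) (σ l) h with h' | h' | h'
  · exact Or.inl (σ.injective h')
  · exact Or.inr (Or.inl (σ.injective h'))
  · exact Or.inr (Or.inr (σ.injective h'))

/-- The QUADRATIC exact sub-slice (same carve-out as `AnfPresentation.QuadRungA`). -/
def quadSlice : PromiseProblem :=
  ⟨CubicANFPair.encode '' {I | (Even I.n ∧ I.value = 1) ∧ IsQuad I.F ∧ IsQuad I.G},
    CubicANFPair.encode '' {I | (Even I.n ∧ I.value = -1) ∧ IsQuad I.F ∧ IsQuad I.G}⟩

/-- PebbleDial helper `quadSlice_yes_subset` (decomp-qadv land package; see the module docstring). -/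
theorem quadSlice_yes_subset {w : List Bool} (hw : w ∈ quadSlice.yes) : w ∈ SignedExactCubicSliceANF.yes := by
  obtain ⟨I, ⟨⟨he, hv⟩, -, -⟩, rfl⟩ := hw
  exact (CubicANFPair.encode_mem_yes_iff I).2 ⟨he, hv⟩

/-- PebbleDial helper `quadSlice_no_subset` (decomp-qadv land package; see the module docstring). -/
theorem quadSlice_no_subset {w : List Bool} (hw : w ∈ quadSlice.no) : w ∈ SignedExactCubicSliceANF.no := by
  obtain ⟨I, ⟨⟨he, hv⟩, -, -⟩, rfl⟩ := hw
  exact (CubicANFPair.encode_mem_no_iff I).2 ⟨he, hv⟩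

/-- Sub-promise monotonicity: whoever solves the slice solves its quadratic part. -/
theorem quadSlice_mem_promiseLift {C : Set (Language Bool)} (h : SignedExactCubicSliceANF ∈ promiseLift C) :
    quadSlice ∈ promiseLift C := by
  obtain ⟨L, hL, hy, hn⟩ := h
  exact ⟨L, hL, fun w hw => hy (quadSlice_yes_subset hw), fun w hw => hn (quadSlice_no_subset hw)⟩

/-- [line · quadratic grade of the rung] the quadratic exact sub-slice is outside promise-(SymTC ∩ P). STRONGER than
`SymRung` (`symRung_of_quadSymRung`); PREDICTED FALSE by the quadratic filter (its negation is `QuadSymEasy`,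
`quadSymEasy_iff`). -/
def QuadSymRung : Prop := quadSlice ∉ promiseLift (SymTC ∩ Classes.P)

/-- [line · non-uniform quadratic grade] (predicted false as well). -/
def QuadSymRungNU : Prop := quadSlice ∉ promiseLift SymTC

/-- PebbleDial helper `symRung_of_quadSymRung` (decomp-qadv land package; see the module docstring). -/
theorem symRung_of_quadSymRung : QuadSymRung → SymRung := fun h hx => h (quadSlice_mem_promiseLift hx)

/-- PebbleDial helper `symRungNU_of_quadSymRungNU` (decomp-qadv land package; see the module docstring). -/
theorem symRungNU_of_quadSymRungNU : QuadSymRungNU → SymRungNU := fun h hx => h (quadSlice_mem_promiseLift hx)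

/-- PebbleDial helper `quadSymRung_of_quadSymRungNU` (decomp-qadv land package; see the module docstring). -/
theorem quadSymRung_of_quadSymRungNU : QuadSymRungNU → QuadSymRung :=
  fun h hx => h (promiseLift_mono Set.inter_subset_left hx)

/-- [prediction · print-assembled, UNDECIDED in the tree · INSTRUMENTABLE] QUADRATIC SYMMETRIC EASINESS: some
polynomial-time language all of whose slices are symmetric threshold circuits answers the sign on the quadratic
exact sub-slice (route to a proof: the sign is `G.const ⊕ Arf(F)`; Arf of a nonsingular form is FPC-definable from
the inverse over `𝔽₂` and the determinant over `ℤ` mod `8`; FPC ⟹ `P`-uniform symmetric threshold circuits). -/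
def QuadSymEasy : Prop := quadSlice ∈ promiseLift (SymTC ∩ Classes.P)

/-- [law] the prediction is literally the negation of the quadratic grade. -/
theorem quadSymEasy_iff : QuadSymEasy ↔ ¬ QuadSymRung := by
  unfold QuadSymEasy QuadSymRung
  exact not_not.symm

/-- [line target · T-free] QUADRATIC `k`-FOOLING PAIRS: fooling pairs inside the quadratic sub-slice (predicted NOT
to exist for large `k`, `not_quadFoolingPairs_of_quadSymEasy`; kept as the typed alternative branch). -/
def QuadFoolingPairs (k : ℕ) : Prop :=
  ∀ n₀ : ℕ, ∃ n, n₀ ≤ n ∧ Even n ∧ ∃ F G F' G' : CubicForm n, (IsQuad F ∧ IsQuad G ∧ IsQuad F' ∧ IsQuad G') ∧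
    CkEquivANF k F G F' G' ∧ (⟨n, F, G⟩ : CubicANFPair).value = 1 ∧ (⟨n, F', G'⟩ : CubicANFPair).value = -1

/-- PebbleDial helper `foolingPairs_of_quadFoolingPairs` (decomp-qadv land package; see the module docstring). -/
theorem foolingPairs_of_quadFoolingPairs {k : ℕ} (h : QuadFoolingPairs k) : FoolingPairs k := by
  intro n₀
  obtain ⟨n, hn, he, F, G, F', G', -, hequiv, h1, h2⟩ := h n₀
  exact ⟨n, hn, he, F, G, F', G', hequiv, h1, h2⟩

/-- ★★ [line law, PROVED] supports + quadratic fooling pairs ⟹ the quadratic non-uniform grade. -/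
theorem quadSymRungNU_of_quadFoolingPairs (hS : SupportTheoremANF) (hF : ∀ k, QuadFoolingPairs k) :
    QuadSymRungNU := by
  rintro ⟨L, ⟨C, hC, hagree⟩, hyes, hno⟩
  obtain ⟨k, n₀, hk⟩ := hS C hC
  obtain ⟨n, hn, he, F, G, F', G', ⟨qF, qG, qF', qG'⟩, hequiv, h1, h2⟩ := hF k n₀
  have ha : accepts C ⟨n, F, G⟩ = true :=
    (hagree _).1 (hyes ⟨⟨n, F, G⟩, ⟨⟨he, h1⟩, qF, qG⟩, rfl⟩)
  have hb : ¬ accepts C ⟨n, F', G'⟩ = true :=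
    fun hacc => hno ⟨⟨n, F', G'⟩, ⟨⟨he, h2⟩, qF', qG'⟩, rfl⟩ ((hagree _).2 hacc)
  have hab : accepts C ⟨n, F, G⟩ = accepts C ⟨n, F', G'⟩ := hk n hn F G F' G' hequiv
  exact hb (hab ▸ ha)

/-- ★ [law · QUADRATIC ABSORPTION, PROVED — the branch the filter predicts is empty] if the fooling-pair line closed
inside the quadratic sub-slice, every symmetric grade of the rung would hold by an argument never touching the
classically-hard part of the promise, and the target would be its residual: `X ↔ RungA ∧ SymLift`. -/
theorem quadratic_absorption (hS : SupportTheoremANF) (hF : ∀ k, QuadFoolingPairs k) :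
    (QuadSymRungNU ∧ QuadSymRung ∧ SymRungNU ∧ SymRung) ∧ (AnfResidual ↔ RungA ∧ SymLift) :=
  have hq : QuadSymRungNU := quadSymRungNU_of_quadFoolingPairs hS hF
  ⟨⟨hq, quadSymRung_of_quadSymRungNU hq, symRungNU_of_quadSymRungNU hq,
      symRung_of_symRungNU (symRungNU_of_quadSymRungNU hq)⟩,
    anfResidual_iff_of_line hS fun k => foolingPairs_of_quadFoolingPairs (hF k)⟩

/-- ★ [law · no quadratic fooling pairs under the prediction, PROVED] -/
theorem not_quadFoolingPairs_of_quadSymEasy (hE : QuadSymEasy) (hS : SupportTheoremANF) :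
    ¬ ∀ k, QuadFoolingPairs k :=
  fun hF => quadSymRungNU_of_quadFoolingPairs hS hF (promiseLift_mono Set.inter_subset_left hE)

/-- ★★ [law · THE QUADRATIC FILTER, PROVED] under the prediction `QuadSymEasy` and the support hypothesis there are
`k`, `n₀` such that NO `k`-fooling pair of even arity `≥ n₀` is quadratic: every fooling pair the line `§4` needs is
properly cubic from some `k` on. -/
theorem quadratic_filter (hE : QuadSymEasy) (hS : SupportTheoremANF) :
    ∃ k n₀ : ℕ, ∀ n, n₀ ≤ n → Even n → ∀ F G F' G' : CubicForm n, IsQuad F → IsQuad G → IsQuad F' → IsQuad G' →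
      CkEquivANF k F G F' G' → (⟨n, F, G⟩ : CubicANFPair).value = 1 → (⟨n, F', G'⟩ : CubicANFPair).value ≠ -1 := by
  obtain ⟨L, ⟨⟨C, hC, hagree⟩, -⟩, hyes, hno⟩ := hE
  obtain ⟨k, n₀, hk⟩ := hS C hC
  refine ⟨k, n₀, fun n hn he F G F' G' qF qG qF' qG' hequiv h1 h2 => ?_⟩
  have ha : accepts C ⟨n, F, G⟩ = true :=
    (hagree _).1 (hyes ⟨⟨n, F, G⟩, ⟨⟨he, h1⟩, qF, qG⟩, rfl⟩)
  have hb : ¬ accepts C ⟨n, F', G'⟩ = true :=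
    fun hacc => hno ⟨⟨n, F', G'⟩, ⟨⟨he, h2⟩, qF', qG'⟩, rfl⟩ ((hagree _).2 hacc)
  have hab : accepts C ⟨n, F, G⟩ = accepts C ⟨n, F', G'⟩ := hk n hn F G F' G' hequiv
  exact hb (hab ▸ ha)


/-! ## §6 The SIGN LAW on the exact slice (PROVED, degree-free) and the reduction of `QuadSymEasy` to ONE
finite-model-theory fact

For an exact pair `(F, G)` the partner `G` is the dual of the bent function `F` up to its constant
(tree `HintDial.isDualOf_of_forrelation_eq_one`).  Reading the duality at `y = 0` gives a degree-free law:
**the sign of an exact pair is `+1` iff `G.const` equals the DOMINANT VALUE of `F`** (`domBit F`: does `F` take the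
value `1` on more than half of the cube?).  For a nonsingular QUADRATIC `F` the dominant value is the Arf invariant of
`F` — so on the quadratic grade the promise problem is literally «read `G.const`, compute `Arf F`», and `QuadSymEasy`
reduces to the single print-assembled fact `ArfSym` (FPC-definability of the Arf invariant of a nonsingular quadratic
form over `𝔽₂` — via determinant / matrix inverse, Dawar–Grohe–Holm–Laubner 2009 — plus the Anderson–Dawar
translation FPC ⟹ `P`-uniform symmetric threshold circuits). -/

/-- [dictionary] The DOMINANT-VALUE bit of a form: `true` iff `Σ_x (-1)^{F(x)} < 0`, i.e. iff `F` takes the value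
`true` on more than half of `{0,1}ⁿ`.  For bent `F` it is the value of the dual at `0`; for nonsingular quadratic `F`
it is the Arf invariant («democratic invariant»). -/
noncomputable def domBit {n : ℕ} (F : CubicForm n) : Bool := decide (∑ x : Fin n → Bool, signOf (F.eval x) < 0)

/-- PebbleDial helper `W_signOf_zero` (decomp-qadv land package; see the module docstring). -/
theorem W_signOf_zero {n : ℕ} (F : CubicForm n) :
    DerivativeWalsh.W (fun x => signOf (F.eval x)) (fun _ => false) = ∑ x, signOf (F.eval x) := by
  unfold DerivativeWalsh.W
  refine sum_congr rfl fun x _ => ?_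
  have : twist x (fun _ : Fin n => false) = 1 := by simp [twist]
  rw [this, mul_one]

/-- ★★ [law · SIGN LAW, `+1` side] for an exact `+1` pair, `G.const = domBit F` (degree-free). -/
theorem const_eq_domBit_of_value_eq_one (I : CubicANFPair) (h : I.value = 1) : I.G.const = domBit I.F := by
  obtain ⟨n, F, G⟩ := I
  change forrelation F.eval G.eval = 1 at h
  have hd := Summit.QuantumAdvantage.QuantumAdvantage.Theorems.HintDial.isDualOf_of_forrelation_eq_one h
    (fun _ => false)
  rw [W_signOf_zero, Summit.QuantumAdvantage.QuantumAdvantage.Theorems.HintDial.eval_zero] at hd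
  have hs : (0 : ℝ) < Real.sqrt (2 ^ n) := Real.sqrt_pos.2 (by positivity)
  show G.const = decide (∑ x : Fin n → Bool, signOf (F.eval x) < 0)
  rw [hd]
  cases G.const
  · simp only [signOf, Bool.false_eq_true, if_false, mul_one]
    exact (decide_eq_false (not_lt.2 hs.le)).symm
  · simp only [signOf, if_true, mul_neg, mul_one]
    exact (decide_eq_true (neg_lt_zero.2 hs)).symm

/-- ★★ [law · SIGN LAW, `-1` side] for an exact `-1` pair, `G.const ≠ domBit F`. -/
theorem const_ne_domBit_of_value_eq_neg_one (I : CubicANFPair) (h : I.value = -1) : I.G.const ≠ domBit I.F := by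
  obtain ⟨n, F, G⟩ := I
  have h' : (⟨n, F, Summit.QuantumAdvantage.QuantumAdvantage.Theorems.HintDial.flipConst G⟩ : CubicANFPair).value
      = 1 := by
    rw [Summit.QuantumAdvantage.QuantumAdvantage.Theorems.HintDial.value_flipConst, h, neg_neg]
  have e := const_eq_domBit_of_value_eq_one _ h'
  change (!G.const) = domBit F at e
  intro hEq
  change G.const = domBit F at hEq
  rw [hEq] at e
  exact Bool.not_ne_self _ e

/-- ★ [law] on the promise the sign is READ OFF `G.const` and `domBit F`: `value = 1 ↔ G.const = domBit F`.
So the content of the whole slice is «compute the dominant value of a cubic form CERTIFIED bent by its partner». -/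
theorem value_eq_one_iff_const_eq_domBit (I : CubicANFPair) (hI : I.value = 1 ∨ I.value = -1) :
    I.value = 1 ↔ I.G.const = domBit I.F := by
  refine ⟨const_eq_domBit_of_value_eq_one I, fun h => ?_⟩
  rcases hI with h1 | h1
  · exact h1
  · exact absurd h (const_ne_domBit_of_value_eq_neg_one I h1)

/-- [line · named print-assembled hypothesis · INSTRUMENTABLE] `ArfSym`: some polynomial-size symmetric threshold
family, agreeing on codes with a polynomial-time language, accepts a QUADRATIC exact instance iff `G.const = domBit F`
— i.e. it computes the Arf invariant of the nonsingular quadratic form `F` (and one input bit).  Assembled from: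
FPC defines the determinant over `ℤ` and the inverse of a nonsingular matrix over `𝔽₂` (Dawar–Grohe–Holm–Laubner,
LICS 2009; Holm 2010), Brown's determinant formula `Arf = F.const ⊕ q₀(B⁻¹a) ⊕ [det_ℤ A ≡ ±3 (8)]`, and
FPC ⟹ `P`-uniform symmetric threshold circuits (Anderson–Dawar 2017).  Not a tree theorem. -/
def ArfSym : Prop :=
  ∃ C : (n : ℕ) → Circuit (AnfIdx n), IsSymTCFamily C ∧
    (∃ L ∈ Classes.P, ∀ I : CubicANFPair, I.encode ∈ L ↔ accepts C I = true) ∧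
    ∀ I : CubicANFPair, Even I.n → IsQuad I.F → IsQuad I.G → (I.value = 1 ∨ I.value = -1) →
      (accepts C I = true ↔ I.G.const = domBit I.F)

/-- ★★ [law] the quadratic filter's prediction REDUCED to the one FMT fact: `ArfSym → QuadSymEasy`
(the algebraic half — the sign law — is kernel-checked above). -/
theorem quadSymEasy_of_arfSym (h : ArfSym) : QuadSymEasy := by
  obtain ⟨C, hC, ⟨L, hLP, hagree⟩, hArf⟩ := h
  refine ⟨L, ⟨⟨C, hC, hagree⟩, hLP⟩, fun w hw => ?_, fun w hw => ?_⟩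
  · obtain ⟨I, ⟨⟨he, hv⟩, qF, qG⟩, rfl⟩ := hw
    exact (hagree I).2 ((hArf I he qF qG (Or.inl hv)).2 (const_eq_domBit_of_value_eq_one I hv))
  · obtain ⟨I, ⟨⟨he, hv⟩, qF, qG⟩, rfl⟩ := hw
    intro hL
    have hacc : accepts C I = true := (hagree I).1 hL
    exact const_ne_domBit_of_value_eq_neg_one I hv ((hArf I he qF qG (Or.inr hv)).1 hacc)

/-- ★ [law] hence the full filter from the FMT fact alone: `ArfSym → SupportTheoremANF →` no quadratic `k`-fooling
pairs from some arity on (for some `k`). -/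
theorem quadratic_filter_of_arfSym (hA : ArfSym) (hS : SupportTheoremANF) :
    ∃ k n₀ : ℕ, ∀ n, n₀ ≤ n → Even n → ∀ F G F' G' : CubicForm n,
      IsQuad F → IsQuad G → IsQuad F' → IsQuad G' → CkEquivANF k F G F' G' →
        (⟨n, F, G⟩ : CubicANFPair).value = 1 → (⟨n, F', G'⟩ : CubicANFPair).value ≠ -1 :=
  quadratic_filter (quadSymEasy_of_arfSym hA) hS

/-- ★ [law · the sign law makes fooling pairs CONCRETE] a `k`-fooling pair is exactly a pair of `C^k`-equivalent
exact ANF structures whose «`G.const = domBit F`» bits DIFFER — the pebble game must hide the dominant value of a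
certified-bent cubic form. -/
theorem foolingPairs_iff_domBit (k : ℕ) : FoolingPairs k ↔ ∀ n₀, ∃ n, n₀ ≤ n ∧ Even n ∧
    ∃ F G F' G' : CubicForm n, CkEquivANF k F G F' G' ∧
      ((⟨n, F, G⟩ : CubicANFPair).value = 1 ∨ (⟨n, F, G⟩ : CubicANFPair).value = -1) ∧
      ((⟨n, F', G'⟩ : CubicANFPair).value = 1 ∨ (⟨n, F', G'⟩ : CubicANFPair).value = -1) ∧
      G.const = domBit F ∧ G'.const ≠ domBit F' := by
  refine forall_congr' fun n₀ => exists_congr fun n => and_congr_right fun _ => and_congr_right fun _ => ?_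
  refine exists_congr fun F => exists_congr fun G => exists_congr fun F' => exists_congr fun G' =>
    and_congr_right fun _ => ⟨fun ⟨h1, h2⟩ => ?_, fun ⟨hI, hI', h1, h2⟩ => ?_⟩
  · exact ⟨Or.inl h1, Or.inr h2, const_eq_domBit_of_value_eq_one ⟨n, F, G⟩ h1,
      const_ne_domBit_of_value_eq_neg_one ⟨n, F', G'⟩ h2⟩
  · refine ⟨(value_eq_one_iff_const_eq_domBit ⟨n, F, G⟩ hI).2 h1, ?_⟩
    rcases hI' with h | h
    · exact absurd (const_eq_domBit_of_value_eq_one ⟨n, F', G'⟩ h) h2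
    · exact h

/-- SUMMARY of the node's logical skeleton (target split, residual split, line, filter, sign law). -/
theorem pebbleDial_summary :
    (AnfResidual ↔ RungA ∧ SymRung ∧ SymLift) ∧ (LiftA ↔ (RungA → SymRung) ∧ SymLift) ∧
      (QuadSymRungNU → SymRungNU) ∧ (SymRungNU → SymRung) ∧ (QuadSymRung → SymRung) ∧
      (SupportTheoremANF → (∀ k, FoolingPairs k) → SymRungNU) ∧
      (SupportTheoremANF → (∀ k, QuadFoolingPairs k) → QuadSymRungNU) ∧
      (QuadSymEasy → SupportTheoremANF → ¬ ∀ k, QuadFoolingPairs k) ∧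
      (∀ I : CubicANFPair, (I.value = 1 ∨ I.value = -1) → (I.value = 1 ↔ I.G.const = domBit I.F)) ∧
      (ArfSym → QuadSymEasy) :=
  ⟨anfResidual_iff, liftA_iff, symRungNU_of_quadSymRungNU, symRung_of_symRungNU, symRung_of_quadSymRung,
    symRungNU_of_foolingPairs, quadSymRungNU_of_quadFoolingPairs, not_quadFoolingPairs_of_quadSymEasy,
    value_eq_one_iff_const_eq_domBit, quadSymEasy_of_arfSym⟩

end Summit.QuantumAdvantage.QuantumAdvantage.Theorems.PebbleDial
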